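import Summits.ResolutionOfSingularities.ResolutionOfSingularities.Theorems.WildCocycleLU4
import Summits.ResolutionOfSingularities.ResolutionOfSingularities.Theorems.RadicialJungCleanModelsLens5GradedBasis
import HarnessLib

/-!
# LimitCollapseLU (1/2) — THE RANK-TWO CERTIFICATE DIES IN THE VALUATION RING

Node «LimitCollapse» (decomp-res lens-1 g36, lens «grading / quantitative ladder»), tree file 1/2.  Door (W-λ₂)
`WildCocycleLU.WildLogRankTwoAbove k O` (tree `WildCocycleLU2`) inside the located residual
`R35 = WildCocycleLU.NonKHToricArchLUKeyHenselDescentQuotTInertTwoMBWildLDTTCy` (tree `WildCocycleLU4`, root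
`closes_cocycle`).  The door's DEFINING datum is an `F_p`-INDEPENDENT PAIR of frame cocycles: for two frame coordinates
`x′_{j₁}, x′_{j₂}` of the `G`-regular model `B = locAtCentre (modelAbove k R K′ t₀) O′`,
«`(g x′_{j₁}/x′_{j₁})^a (g x′_{j₂}/x′_{j₂})^b = gφ/φ` with `φ, φ⁻¹ ∈ B` forces `[K′:K] ∣ a` and `[K′:K] ∣ b`».

THIS FILE grades that clause by the one integer the lineage had not moved — the INDEX `[K′:K] = p` against the `p²`
frame monomials `x′_{j₁}^i x′_{j₂}^j` (`0 ≤ i, j < p`) — ALONG THE VALUATION instead of on the model, and proves,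
hypothesis-free (every field extension of degree `≥ 2`, every valuation ring `O′` of the top, every `K`-automorphism,
every pair of non-zero elements, equal or not):

* `exists_dependent_pair_valuationRing` ✓ — there are `a, b ∈ ℤ`, NOT both divisible by `[K′:K]` (indeed
  `|a|, |b| < [K′:K]`), and a UNIT `φ` of `O′` with `u₁^a u₂^b = gφ/φ`.  Proof: the `p²` monomials are `K`-linearly
  DEPENDENT (`p² > [K′:K]`, Mathlib `LinearIndependent.fintype_card_le_finrank`); in a non-trivial dependence two
  non-zero terms `c·x₁^i x₂^j`, `c′·x₁^{i′} x₂^{j′}` have THE SAME VALUE (graded sums: tree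
  `GradedBasis.eq_zero_of_sum_eq_zero_of_pairwise`, landed with the RadicialJung lens-5 files); their quotient `φ` is
  a unit of `O′`, the coefficients `c, c′ ∈ K` are `g`-fixed, so `gφ/φ = u₁^{i−i′} u₂^{j−j′}`.
* `not_rankTwoClause_of_valuationRing_le` ✓ — COROLLARY: the door's last clause with `B` replaced by ANY subring
  `S ⊇ O′` is FALSE, for every pair of indices.

READING (the diagnosis of the door, see file 2's module docstring for the ladder consequences).  Cocycle rank `≥ 2`
is a property of the MODEL `B ⊊ O′`, never of the PLACE: `O′` is the union of the `G`-stable models above each `R`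
(every `φ^{±1} ∈ O′` lies in SOME f.g. `G`-stable model above `R` inside `O′`), so the independent pair becomes
DEPENDENT on a cofinal family of `G`-stable MODELS, and the door is exactly the question whether that family can be
taken `G`-REGULAR WITH A LOG-DIAGONAL FRAME — i.e. whether the INVARIANT RATIO `c/c′ ∈ K` carried by the collapsing
unit can be principalized along `v` inside such models: the embedded (principalization) statement behind lane (B) of
critic letter 239c, in print for ambient dimension `≤ 3` [CossartJannsenSaito2020] and open in the located range
`d ≥ 4`.  In `H¹`-currency: `H¹(G, O′^×) ↪ Γ_{K′}/Γ_K` (Hilbert 90; order `e ∈ {1, p}`), so over a VALUE-IMMEDIATE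
layer (`e = 1`) EVERY frame cocycle is a unit coboundary in `O′` (limit rank `0`), and over `e = p` the limit rank is
`≤ 1`.  Nothing here decides a place: the theorem LOCATES lane (B)'s obstruction (tag DECIDED · STRUCTURE).
«Why this is novel»: every earlier statement about (W-λ″)/(W-λ₂) (g33–g35) graded frames ON THE MODEL (pivot shapes,
luck, Artin–Schreier pairs); this is the first statement of the lineage about the cocycle group OF THE PLACE, and it is
a no-go for «rank» as a place-level grading: any future λ₂-law must be a statement about models carrying the
principalized ratio.  «Why strictly weaker»: a theorem (no binder); it implies neither the door nor its negation
(probe file, N1/N5).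
[cite: KiralyLutkebohmert2013, Thm. 2] [cite: CossartJannsenSaito2020] [cite: KnafKuhlmann2009, Lemma 3.7]
-/

noncomputable section

open Summit.ResolutionOfSingularities.ResolutionOfSingularities.Theorems.RadicialJung.CleanModels.Lens5.GradedBasis

namespace Summit.ResolutionOfSingularities.ResolutionOfSingularities.Theorems.WildCocycleLU

section LimitCollapse

variable {K : Type} [Field K] {K' : Type} [Field K'] [Algebra K K']

/-- **LIMIT COLLAPSE (kernel, hypothesis-free).**  In a finite field extension `K′/K` of degree `n ≥ 2`, for ANY
valuation ring `O′` of `K′`, ANY `K`-automorphism `g` and ANY two non-zero elements `x₁, x₂` (equal or not), the two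
cocycles `u_i = g x_i / x_i` are DEPENDENT modulo unit coboundaries of `O′`: `u₁^a u₂^b = gφ/φ` with `φ` a unit of
`O′` and `(a, b)` NOT both divisible by `n` (the proof gives `|a|, |b| < n`).  Proof: the `n²` monomials `x₁^i x₂^j`
(`i, j < n`) are `K`-linearly dependent; in a non-trivial dependence two non-zero terms have the same value (graded
sums, tree `eq_zero_of_sum_eq_zero_of_pairwise`); their quotient is the unit `φ`, and the coefficients are `g`-fixed.
[folklore] -/
theorem exists_dependent_pair_valuationRing [FiniteDimensional K K'] (h2 : 2 ≤ Module.finrank K K')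
    (O' : ValuationSubring K') (g : K' ≃ₐ[K] K') {x₁ x₂ : K'} (hx₁ : x₁ ≠ 0) (hx₂ : x₂ ≠ 0) :
    ∃ a b : ℤ, ∃ φ : K', φ ∈ O' ∧ φ⁻¹ ∈ O' ∧
      (g x₁ / x₁) ^ a * (g x₂ / x₂) ^ b = g φ / φ ∧
      ¬ (((Module.finrank K K' : ℕ) : ℤ) ∣ a ∧ ((Module.finrank K K' : ℕ) : ℤ) ∣ b) := by
  classical
  set p : ℕ := Module.finrank K K' with hpdef
  -- the `p²` monomials and their linear dependence over `K`
  set bm : Fin p × Fin p → K' := fun ij => x₁ ^ (ij.1 : ℕ) * x₂ ^ (ij.2 : ℕ) with hbm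
  have hb0 : ∀ ij, bm ij ≠ 0 := fun ij => mul_ne_zero (pow_ne_zero _ hx₁) (pow_ne_zero _ hx₂)
  have hdep : ¬ LinearIndependent K bm := by
    intro hli
    have hcard := hli.fintype_card_le_finrank
    rw [Fintype.card_prod, Fintype.card_fin, ← hpdef] at hcard
    nlinarith
  obtain ⟨c, hsum, i₀, hi₀⟩ := Fintype.not_linearIndependent_iff.mp hdep
  set f : Fin p × Fin p → K' := fun ij => algebraMap K K' (c ij) * bm ij with hf
  have hsum' : ∑ ij ∈ (Finset.univ : Finset (Fin p × Fin p)), f ij = 0 := by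
    rw [← hsum]
    exact Finset.sum_congr rfl fun ij _ => (Algebra.smul_def (c ij) (bm ij)).symm
  -- two non-zero terms with the same value
  have hpair : ∃ i j, i ≠ j ∧ f i ≠ 0 ∧ O'.valuation (f i) = O'.valuation (f j) := by
    by_contra hne
    have hne' : ∀ i j, i ≠ j → f i ≠ 0 → O'.valuation (f i) ≠ O'.valuation (f j) :=
      fun i j hij hi0 hv => hne ⟨i, j, hij, hi0, hv⟩
    have hall := eq_zero_of_sum_eq_zero_of_pairwise O'.valuation Finset.univ f
      (fun i _ j _ hij hi0 => hne' i j hij hi0) hsum'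
    have h0 : f i₀ = 0 := hall i₀ (Finset.mem_univ _)
    rcases mul_eq_zero.mp h0 with h | h
    · exact hi₀ ((map_eq_zero _).mp h)
    · exact hb0 i₀ h
  obtain ⟨i, j, hij, hfi, hval⟩ := hpair
  have hfj : f j ≠ 0 := by
    intro h0
    rw [h0, map_zero] at hval
    exact hfi ((map_eq_zero _).mp hval)
  have hvi : O'.valuation (f i) ≠ 0 := (map_ne_zero _).mpr hfi
  have hvj : O'.valuation (f j) ≠ 0 := (map_ne_zero _).mpr hfj
  -- the cocycles act diagonally on the terms
  have hgx₁ : g x₁ ≠ 0 := fun h => hx₁ (by simpa using congrArg g.symm h)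
  have hgx₂ : g x₂ ≠ 0 := fun h => hx₂ (by simpa using congrArg g.symm h)
  have hu₁ : g x₁ / x₁ ≠ 0 := div_ne_zero hgx₁ hx₁
  have hu₂ : g x₂ / x₂ ≠ 0 := div_ne_zero hgx₂ hx₂
  have hgf : ∀ ij, g (f ij) = ((g x₁ / x₁) ^ (ij.1 : ℕ) * (g x₂ / x₂) ^ (ij.2 : ℕ)) * f ij := by
    intro ij
    simp only [hf, hbm, map_mul, map_pow, AlgEquiv.commutes]
    rw [div_pow, div_pow, div_mul_div_comm]
    field_simp
  refine ⟨((i.1 : ℕ) : ℤ) - ((j.1 : ℕ) : ℤ), ((i.2 : ℕ) : ℤ) - ((j.2 : ℕ) : ℤ), f i / f j, ?_, ?_, ?_, ?_⟩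
  · rw [← O'.valuation_le_one_iff, map_div₀, hval, div_self hvj]
  · rw [← O'.valuation_le_one_iff, inv_div, map_div₀, ← hval, div_self hvi]
  · rw [zpow_sub₀ hu₁, zpow_sub₀ hu₂, zpow_natCast, zpow_natCast, zpow_natCast, zpow_natCast, map_div₀, hgf i,
      hgf j]
    field_simp
  · rintro ⟨ha, hb⟩
    have hi1 := (i.1).isLt
    have hj1 := (j.1).isLt
    have hi2 := (i.2).isLt
    have hj2 := (j.2).isLt
    have ha0 := Int.eq_zero_of_dvd_of_natAbs_lt_natAbs ha (by omega)
    have hb0' := Int.eq_zero_of_dvd_of_natAbs_lt_natAbs hb (by omega)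
    apply hij
    refine Prod.ext (Fin.ext ?_) (Fin.ext ?_) <;> omega

/-- **COROLLARY [negative lemma]: the rank-two clause of `λ₂` FAILS over `O′` — it must be read on the model `B`.**  The LAST clause of
`WildCocycleLU.WildLogRankTwoAbove` — «`u_{j₁}^a u_{j₂}^b = gφ/φ` with `φ, φ⁻¹ ∈ B` forces `[K′:K] ∣ a` and
`[K′:K] ∣ b`» — is FALSE as soon as the subring `B` contains the valuation ring `O′`, for every pair of indices
`j₁, j₂` (equal or not) of a family of non-zero elements.  Cocycle rank `≥ 2` is a property of the MODEL
`B = locAtCentre (modelAbove k R K′ t₀) O′ ⊊ O′`, never of the place. [folklore] -/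
theorem not_rankTwoClause_of_valuationRing_le [FiniteDimensional K K'] (h2 : 2 ≤ Module.finrank K K')
    (O' : ValuationSubring K') (S : Subring K') (hS : O'.toSubring ≤ S) (g : K' ≃ₐ[K] K')
    {d : ℕ} (x' : Fin d → K') (hx' : ∀ j, x' j ≠ 0) (j₁ j₂ : Fin d) :
    ¬ (∀ a b : ℤ, ∀ φ : K', φ ∈ S → φ⁻¹ ∈ S →
        (g (x' j₁) / x' j₁) ^ a * (g (x' j₂) / x' j₂) ^ b = g φ / φ →
        ((Module.finrank K K' : ℕ) : ℤ) ∣ a ∧ ((Module.finrank K K' : ℕ) : ℤ) ∣ b) := by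
  intro hcl
  obtain ⟨a, b, φ, hφ, hφi, hab, hndvd⟩ :=
    exists_dependent_pair_valuationRing h2 O' g (hx' j₁) (hx' j₂)
  exact hndvd (hcl a b φ (hS hφ) (hS hφi) hab)

/-- [negative lemma] The same over the valuation ring itself (`S = O′`): the rank-two clause of
`WildLogRankTwoAbove` read over `O′` instead of `B` is false. [folklore] -/
theorem not_rankTwoClause_valuationRing [FiniteDimensional K K'] (h2 : 2 ≤ Module.finrank K K')
    (O' : ValuationSubring K') (g : K' ≃ₐ[K] K') {d : ℕ} (x' : Fin d → K') (hx' : ∀ j, x' j ≠ 0)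
    (j₁ j₂ : Fin d) :
    ¬ (∀ a b : ℤ, ∀ φ : K', φ ∈ O' → φ⁻¹ ∈ O' →
        (g (x' j₁) / x' j₁) ^ a * (g (x' j₂) / x' j₂) ^ b = g φ / φ →
        ((Module.finrank K K' : ℕ) : ℤ) ∣ a ∧ ((Module.finrank K K' : ℕ) : ℤ) ∣ b) :=
  fun hcl => not_rankTwoClause_of_valuationRing_le h2 O' O'.toSubring le_rfl g x' hx' j₁ j₂
    fun a b φ hφ hφi hab => hcl a b φ hφ hφi hab

/-- A prime degree is `≥ 2`: the door's header `(Module.finrank K K′).Prime` feeds `h2`. [folklore] -/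
theorem two_le_finrank_of_prime (hp : (Module.finrank K K').Prime) : 2 ≤ Module.finrank K K' :=
  hp.two_le

end LimitCollapse

end Summit.ResolutionOfSingularities.ResolutionOfSingularities.Theorems.WildCocycleLU

end
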